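import Literature.NumberTheory.Sieve.LargeSieveInequality
import HarnessLib

/-!
# Route `PrimeLevelFamEdge`, crux K_B (stmt-Parity-20343), line `diagonal_kernel_split` rev 4, plan Ω —
# **the additive large sieve over a FAMILY of rational frequencies with a common denominator** (worker-3 stub
# `OffDiagKFamilyLargeSieve`, a8P-short regime)

The short-moduli principal block of a8P (S4 / `OffDiagPrincipalShortBound`) carries phases `e(−ab·k/(q(r+1)))` and
`e(l·m·k/D)` for a finite family of numerators `k` over ONE denominator `D`. The tree's large sieve
(`LargeSieve.largeSieve_wellSpaced`, Huxley/Bombieri; `largeSieve_farey` at the Farey points) speaks of `δ`-spaced points;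
the points `k/D (mod 1)` of such a family are `1/D`-spaced as soon as the `k` are distinct mod `D`, and in general the
family splits into at most `m` = (max multiplicity of `k mod D`) such sub-families. This file proves, generically (no K_B
objects are imported):

* `largeSieve_residues` — the complete additive large sieve mod `D`: for complex `a_n` on `M₀ < n ≤ M₀ + N`,
  `Σ_{r mod D} ‖Σ_n a_n e(n r/D)‖² ≤ (N + 1 + 2D)·Σ‖a_n‖²` (`largeSieve_wellSpaced` with `δ = 1/D`);
* **`largeSieve_family_mod`** — for any finite family `(ν_i)_{i∈R}` of integer numerators with
  `#{i : ν_i ≡ r (mod D)} ≤ m` for every residue `r`: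
  `Σ_{i∈R} ‖Σ_n a_n e(n ν_i/D)‖² ≤ m·(N + 1 + 2D)·Σ‖a_n‖²` (each `‖Σ_n a_n e(n ν/D)‖²` depends on `ν mod D` only,
  `e_mul_div_eq_of_emod`); `largeSieve_family_mod_nat` — the same for coefficients indexed by `1 ≤ n ≤ Y` in `ℕ`;
* **`sum_norm_bilinear_le`** — the bilinear corollary (Cauchy–Schwarz in `l`, then in the family, then the family large
  sieve for the numerators `l·ν_i`): for `x, y : ℕ → ℂ` on `[1, L]`, `[1, M]` and `m′` with
  `#{(i,l) ∈ R × [1,L] : l·ν_i ≡ r (mod D)} ≤ m′` for all `r`,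
  `(Σ_{i∈R} ‖Σ_{l≤L} Σ_{m≤M} x_l y_m e(l m ν_i/D)‖)² ≤ #R · Σ‖x_l‖² · (m′·(M + 1 + 2D)·Σ‖y_m‖²)`,
  and `sum_norm_bilinear_le_sqrt` (the same with square roots).

`e t = exp(2πit)` is `LargeSieve.e` (Mathlib's `Real.fourierChar` coerced to `ℂ`). Constants are the weak ones of the
tree's large sieve (`N + 1 + 2δ⁻¹`); the multiplicities `m`, `m′` are hypothesis-parameters (the consumer counts them).
Standard axioms; helper toward `stub_offDiagBelowSlack_io` (feeds prover-5's a8P-short bound); closes nothing by itself.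
«The programme SEARCHES and TYPES; no claim about Landau–Siegel zeros, Theorems 1–2 of arXiv:2211.02515 or
a repaired Margin232 until a kernel theorem says so.»
-/

noncomputable section

open Finset

namespace Summit.Parity.GeneralizedHardyLittlewood.Theorems.BeyondDiagonalBeatsQuarter.OffDiag

open Literature.NumberTheory.Sieve.LargeSieve

/-! ### Periodicity and spacing of the points `ν/D` -/

/-- **`e(n ν/D)` depends on `ν mod D` only**: `e(n·ν/D) = e(n·(ν mod D)/D)` for integers `n, ν` and `D ≥ 1`.
[folklore] -/
theorem e_mul_div_eq_of_emod {D : ℕ} (hD : 0 < D) (n ν : ℤ) :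
    e ((n : ℝ) * (ν : ℝ) / D) = e ((n : ℝ) * ((ν % D : ℤ) : ℝ) / D) := by
  have hD' : (D : ℝ) ≠ 0 := by exact_mod_cast hD.ne'
  have hdiv : (ν : ℤ) = (D : ℤ) * (ν / D) + ν % D := by have := Int.emod_add_mul_ediv ν (D : ℤ); omega
  have : (n : ℝ) * (ν : ℝ) / D = (n : ℝ) * ((ν % D : ℤ) : ℝ) / D + ((n * (ν / D) : ℤ) : ℝ) := by
    have hν : (ν : ℝ) = (D : ℝ) * ((ν / D : ℤ) : ℝ) + ((ν % D : ℤ) : ℝ) := by exact_mod_cast hdiv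
    rw [hν]
    push_cast
    field_simp
    ring
  rw [this, e_add_int]

/-- The residue of an integer mod `D` as a real: `((ν : ZMod D).val : ℝ) = ((ν mod D : ℤ) : ℝ)` (`D ≥ 1`). [folklore] -/
theorem zmod_val_cast_eq_emod {D : ℕ} [NeZero D] (ν : ℤ) :
    (((ν : ZMod D).val : ℕ) : ℝ) = ((ν % D : ℤ) : ℝ) := by
  have h := ZMod.val_intCast (n := D) ν
  exact_mod_cast h

/-- **The points `r/D`, `r mod D`, are `1/D`-spaced modulo 1**: for residues `r ≠ s` and every integer `k`,
`1/D ≤ |s/D − r/D − k|`. [folklore] -/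
theorem zmod_points_spaced {D : ℕ} [NeZero D] {r s : ZMod D} (hrs : r ≠ s) (k : ℤ) :
    (1 : ℝ) / D ≤ |((s.val : ℕ) : ℝ) / D - ((r.val : ℕ) : ℝ) / D - k| := by
  have hD : (0 : ℝ) < D := by exact_mod_cast NeZero.pos D
  have hz : ((s.val : ℤ) - r.val - k * D) ≠ 0 := by
    intro h
    have hs := ZMod.val_lt s
    have hr := ZMod.val_lt r
    have hk : k = 0 := by
      rcases lt_trichotomy k 0 with hk | hk | hk
      · nlinarith
      · exact hk
      · nlinarith
    subst hk
    have : s.val = r.val := by omega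
    exact hrs (ZMod.val_injective D this).symm
  have h1 : (1 : ℝ) ≤ |(((s.val : ℤ) - r.val - k * D : ℤ) : ℝ)| := by
    rw [← Int.cast_abs]; exact_mod_cast Int.one_le_abs hz
  have heq : ((s.val : ℕ) : ℝ) / D - ((r.val : ℕ) : ℝ) / D - k = (((s.val : ℤ) - r.val - k * D : ℤ) : ℝ) / D := by
    push_cast
    field_simp
  rw [heq, abs_div, abs_of_pos hD]
  exact div_le_div_of_nonneg_right h1 hD.le

/-! ### The complete additive large sieve mod `D` and the family version -/

/-- **The complete additive large sieve modulo `D`** (`D ≥ 1`): for complex `a_n` on `M₀ < n ≤ M₀ + N`,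
`Σ_{r mod D} ‖Σ_n a_n e(n r/D)‖² ≤ (N + 1 + 2D)·Σ_n ‖a_n‖²` — `largeSieve_wellSpaced` at the `1/D`-spaced points `r/D`.
[cite: Huxley1972, Ch. 7, (7.8)] -/
theorem largeSieve_residues {D : ℕ} [NeZero D] (a : ℤ → ℂ) (M₀ : ℤ) (N : ℕ) :
    ∑ r : ZMod D, ‖∑ n ∈ Ioc M₀ (M₀ + N), a n * e ((n : ℝ) * ((r.val : ℕ) : ℝ) / D)‖ ^ 2 ≤
      ((N : ℝ) + 1 + 2 * D) * ∑ n ∈ Ioc M₀ (M₀ + N), ‖a n‖ ^ 2 := by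
  have hD : (0 : ℝ) < D := by exact_mod_cast NeZero.pos D
  have hδ : (0 : ℝ) < 1 / D := by positivity
  have h := largeSieve_wellSpaced (Finset.univ : Finset (ZMod D)) (fun r ↦ ((r.val : ℕ) : ℝ) / D) hδ
    (fun r _ s _ hrs k ↦ zmod_points_spaced hrs k) a M₀ N
  have h2 : (2 : ℝ) / (1 / D) = 2 * D := by field_simp
  rw [h2] at h
  have hx : ∀ r : ZMod D, ∑ n ∈ Ioc M₀ (M₀ + N), a n * e ((n : ℝ) * ((r.val : ℕ) : ℝ) / D) =
      ∑ n ∈ Ioc M₀ (M₀ + N), a n * e ((n : ℝ) * (((r.val : ℕ) : ℝ) / D)) :=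
    fun r ↦ Finset.sum_congr rfl fun n _ ↦ by rw [mul_div_assoc]
  simp_rw [hx]
  exact h

/-- **The additive large sieve over a family of rational frequencies with a common denominator.** For `D ≥ 1`, a finite
family of integer numerators `(ν_i)_{i∈R}` with `#{i ∈ R : ν_i ≡ r (mod D)} ≤ m` for every residue `r`, and complex `a_n`
on `M₀ < n ≤ M₀ + N`: `Σ_{i∈R} ‖Σ_n a_n e(n·ν_i/D)‖² ≤ m·(N + 1 + 2D)·Σ_n ‖a_n‖²`. [folklore] -/
theorem largeSieve_family_mod {ι : Type*} (R : Finset ι) (ν : ι → ℤ) {D : ℕ} (hD : 0 < D) {m : ℕ}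
    (hm : ∀ r : ZMod D, (R.filter (fun i ↦ (ν i : ZMod D) = r)).card ≤ m) (a : ℤ → ℂ) (M₀ : ℤ) (N : ℕ) :
    ∑ i ∈ R, ‖∑ n ∈ Ioc M₀ (M₀ + N), a n * e ((n : ℝ) * (ν i : ℝ) / D)‖ ^ 2 ≤
      (m : ℝ) * (((N : ℝ) + 1 + 2 * D) * ∑ n ∈ Ioc M₀ (M₀ + N), ‖a n‖ ^ 2) := by
  classical
  haveI : NeZero D := ⟨hD.ne'⟩
  -- the summand depends on `ν i mod D` only
  set g : ZMod D → ℝ := fun r ↦ ‖∑ n ∈ Ioc M₀ (M₀ + N), a n * e ((n : ℝ) * ((r.val : ℕ) : ℝ) / D)‖ ^ 2 with hg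
  have hg0 : ∀ r, 0 ≤ g r := fun r ↦ by positivity
  have hper : ∀ i ∈ R, ‖∑ n ∈ Ioc M₀ (M₀ + N), a n * e ((n : ℝ) * (ν i : ℝ) / D)‖ ^ 2 = g (ν i : ZMod D) := by
    intro i _
    simp only [hg, zmod_val_cast_eq_emod]
    congr 2
    exact Finset.sum_congr rfl fun n _ ↦ by rw [e_mul_div_eq_of_emod hD]
  rw [Finset.sum_congr rfl hper, ← Finset.sum_fiberwise_of_maps_to (fun i (_ : i ∈ R) ↦ Finset.mem_univ (ν i : ZMod D))]
  calc ∑ r : ZMod D, ∑ i ∈ R.filter (fun i ↦ (ν i : ZMod D) = r), g (ν i : ZMod D)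
      = ∑ r : ZMod D, ((R.filter (fun i ↦ (ν i : ZMod D) = r)).card : ℝ) * g r := by
        refine Finset.sum_congr rfl fun r _ ↦ ?_
        rw [Finset.sum_congr rfl fun i hi ↦ by rw [(Finset.mem_filter.mp hi).2], Finset.sum_const, nsmul_eq_mul]
    _ ≤ ∑ r : ZMod D, (m : ℝ) * g r := Finset.sum_le_sum fun r _ ↦
        mul_le_mul_of_nonneg_right (by exact_mod_cast hm r) (hg0 r)
    _ = (m : ℝ) * ∑ r : ZMod D, g r := by rw [Finset.mul_sum]
    _ ≤ (m : ℝ) * (((N : ℝ) + 1 + 2 * D) * ∑ n ∈ Ioc M₀ (M₀ + N), ‖a n‖ ^ 2) :=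
        mul_le_mul_of_nonneg_left (largeSieve_residues a M₀ N) (Nat.cast_nonneg _)

/-- `(0, Y] ∩ ℤ` is the image of `{1, …, Y} ⊂ ℕ`. [folklore] -/
theorem Ioc_zero_eq_map_Icc (Y : ℕ) : Ioc (0 : ℤ) Y = (Icc 1 Y).map Nat.castEmbedding := by
  ext x
  simp only [Finset.mem_Ioc, Finset.mem_map, Finset.mem_Icc, Nat.castEmbedding_apply]
  constructor
  · rintro ⟨h1, h2⟩
    refine ⟨x.toNat, ⟨by omega, by omega⟩, by omega⟩
  · rintro ⟨u, ⟨hu1, hu2⟩, rfl⟩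
    constructor <;> omega

/-- **The family large sieve for coefficients on `1 ≤ n ≤ Y` in `ℕ`**: under the hypotheses of
`largeSieve_family_mod`, `Σ_{i∈R} ‖Σ_{n=1}^{Y} a_n e(n·ν_i/D)‖² ≤ m·(Y + 1 + 2D)·Σ_{n=1}^{Y} ‖a_n‖²`. [folklore] -/
theorem largeSieve_family_mod_nat {ι : Type*} (R : Finset ι) (ν : ι → ℤ) {D : ℕ} (hD : 0 < D) {m : ℕ}
    (hm : ∀ r : ZMod D, (R.filter (fun i ↦ (ν i : ZMod D) = r)).card ≤ m) (a : ℕ → ℂ) (Y : ℕ) :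
    ∑ i ∈ R, ‖∑ n ∈ Icc 1 Y, a n * e ((n : ℝ) * (ν i : ℝ) / D)‖ ^ 2 ≤
      (m : ℝ) * (((Y : ℝ) + 1 + 2 * D) * ∑ n ∈ Icc 1 Y, ‖a n‖ ^ 2) := by
  have h := largeSieve_family_mod R ν hD hm (fun n : ℤ ↦ a n.toNat) 0 Y
  rw [zero_add, Ioc_zero_eq_map_Icc] at h
  simp only [Finset.sum_map, Nat.castEmbedding_apply, Int.cast_natCast, Int.toNat_natCast] at h
  exact h

/-! ### The bilinear corollary -/

/-- **Bilinear sums over a family of rational frequencies (squared form).** For `D ≥ 1`, a finite family `(ν_i)_{i∈R}` of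
integer numerators, `x, y : ℕ → ℂ` read on `[1, L]` and `[1, M]`, and `m′` with
`#{(i, l) ∈ R × [1, L] : l·ν_i ≡ r (mod D)} ≤ m′` for every residue `r`:
`(Σ_{i∈R} ‖Σ_{l≤L} Σ_{m≤M} x_l y_m e(l·m·ν_i/D)‖)² ≤ #R · (Σ_l ‖x_l‖²) · (m′·(M + 1 + 2D)·Σ_m ‖y_m‖²)`
(Cauchy–Schwarz in `l`, Cauchy–Schwarz over the family, `largeSieve_family_mod_nat` for the numerators `l·ν_i`).
[folklore] -/
theorem sum_norm_bilinear_sq_le {ι : Type*} (R : Finset ι) (ν : ι → ℤ) {D : ℕ} (hD : 0 < D) (L M : ℕ)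
    (x y : ℕ → ℂ) {m' : ℕ}
    (hm' : ∀ r : ZMod D, ((R ×ˢ Icc 1 L).filter (fun p ↦ (((p.2 : ℤ) * ν p.1 : ℤ) : ZMod D) = r)).card ≤ m') :
    (∑ i ∈ R, ‖∑ l ∈ Icc 1 L, ∑ m ∈ Icc 1 M, x l * y m * e ((l : ℝ) * (m : ℝ) * (ν i : ℝ) / D)‖) ^ 2 ≤
      (R.card : ℝ) * (∑ l ∈ Icc 1 L, ‖x l‖ ^ 2) *
        ((m' : ℝ) * (((M : ℝ) + 1 + 2 * D) * ∑ m ∈ Icc 1 M, ‖y m‖ ^ 2)) := by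
  classical
  -- the inner `m`-sums, indexed by the pair `(i, l)` with numerator `l·ν_i`
  set A : ι × ℕ → ℂ := fun p ↦ ∑ m ∈ Icc 1 M, y m * e ((m : ℝ) * (((p.2 : ℤ) * ν p.1 : ℤ) : ℝ) / D) with hA
  set X : ℝ := ∑ l ∈ Icc 1 L, ‖x l‖ ^ 2 with hX
  set T : ι → ℝ := fun i ↦ ∑ l ∈ Icc 1 L, ‖A (i, l)‖ ^ 2 with hT
  have hX0 : 0 ≤ X := Finset.sum_nonneg fun _ _ ↦ by positivity
  have hT0 : ∀ i, 0 ≤ T i := fun i ↦ Finset.sum_nonneg fun _ _ ↦ by positivity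
  -- rewrite each bilinear sum as `Σ_l x_l A(i,l)`
  have hB : ∀ i, ∑ l ∈ Icc 1 L, ∑ m ∈ Icc 1 M, x l * y m * e ((l : ℝ) * (m : ℝ) * (ν i : ℝ) / D) =
      ∑ l ∈ Icc 1 L, x l * A (i, l) := by
    intro i
    refine Finset.sum_congr rfl fun l _ ↦ ?_
    rw [hA, Finset.mul_sum]
    refine Finset.sum_congr rfl fun m _ ↦ ?_
    push_cast
    rw [mul_assoc]
    congr 3
    ring
  -- Cauchy–Schwarz in `l`: `‖Σ_l x_l A(i,l)‖ ≤ √X · √(T i)`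
  have hCS1 : ∀ i, ‖∑ l ∈ Icc 1 L, x l * A (i, l)‖ ≤ Real.sqrt X * Real.sqrt (T i) := by
    intro i
    refine (norm_sum_le _ _).trans ?_
    have := Real.sum_mul_le_sqrt_mul_sqrt (Icc 1 L) (fun l ↦ ‖x l‖) (fun l ↦ ‖A (i, l)‖)
    simp only [hX, hT]
    refine le_trans (le_of_eq (Finset.sum_congr rfl fun l _ ↦ norm_mul _ _)) this
  -- sum over the family and Cauchy–Schwarz again
  have hstep : ∑ i ∈ R, ‖∑ l ∈ Icc 1 L, x l * A (i, l)‖ ≤ Real.sqrt X * ∑ i ∈ R, Real.sqrt (T i) := by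
    rw [Finset.mul_sum]
    exact Finset.sum_le_sum fun i _ ↦ hCS1 i
  have hCS2 : ∑ i ∈ R, Real.sqrt (T i) ≤ Real.sqrt (R.card : ℝ) * Real.sqrt (∑ i ∈ R, T i) := by
    have := Real.sum_sqrt_mul_sqrt_le R (f := fun _ ↦ (1 : ℝ)) (g := T) (fun _ ↦ zero_le_one) hT0
    simp only [Real.sqrt_one, one_mul, Finset.sum_const, nsmul_eq_mul, mul_one] at this
    exact this
  -- the family large sieve for the numerators `l·ν_i`
  have hLS : ∑ i ∈ R, T i ≤ (m' : ℝ) * (((M : ℝ) + 1 + 2 * D) * ∑ m ∈ Icc 1 M, ‖y m‖ ^ 2) := by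
    have h := largeSieve_family_mod_nat (R ×ˢ Icc 1 L) (fun p ↦ (p.2 : ℤ) * ν p.1) hD hm' y M
    rw [Finset.sum_product] at h
    exact h
  have hLS0 : 0 ≤ ∑ i ∈ R, T i := Finset.sum_nonneg fun i _ ↦ hT0 i
  -- assemble
  have hmain : ∑ i ∈ R, ‖∑ l ∈ Icc 1 L, x l * A (i, l)‖ ≤
      Real.sqrt X * (Real.sqrt (R.card : ℝ) * Real.sqrt (∑ i ∈ R, T i)) :=
    hstep.trans (mul_le_mul_of_nonneg_left hCS2 (Real.sqrt_nonneg _))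
  have hlhs0 : 0 ≤ ∑ i ∈ R, ‖∑ l ∈ Icc 1 L, x l * A (i, l)‖ := Finset.sum_nonneg fun _ _ ↦ norm_nonneg _
  simp_rw [hB]
  calc (∑ i ∈ R, ‖∑ l ∈ Icc 1 L, x l * A (i, l)‖) ^ 2
      ≤ (Real.sqrt X * (Real.sqrt (R.card : ℝ) * Real.sqrt (∑ i ∈ R, T i))) ^ 2 :=
        pow_le_pow_left₀ hlhs0 hmain 2
    _ = (R.card : ℝ) * X * ∑ i ∈ R, T i := by
        rw [mul_pow, mul_pow, Real.sq_sqrt hX0, Real.sq_sqrt (Nat.cast_nonneg _), Real.sq_sqrt hLS0]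
        ring
    _ ≤ (R.card : ℝ) * X * ((m' : ℝ) * (((M : ℝ) + 1 + 2 * D) * ∑ m ∈ Icc 1 M, ‖y m‖ ^ 2)) :=
        mul_le_mul_of_nonneg_left hLS (mul_nonneg (Nat.cast_nonneg _) hX0)

/-- **Bilinear sums over a family of rational frequencies (square-root form)**: under the hypotheses of
`sum_norm_bilinear_sq_le`,
`Σ_{i∈R} ‖Σ_{l≤L} Σ_{m≤M} x_l y_m e(l·m·ν_i/D)‖ ≤ √#R · √(Σ_l ‖x_l‖²) · √(m′·(M + 1 + 2D)·Σ_m ‖y_m‖²)`. [folklore] -/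
theorem sum_norm_bilinear_le_sqrt {ι : Type*} (R : Finset ι) (ν : ι → ℤ) {D : ℕ} (hD : 0 < D) (L M : ℕ)
    (x y : ℕ → ℂ) {m' : ℕ}
    (hm' : ∀ r : ZMod D, ((R ×ˢ Icc 1 L).filter (fun p ↦ (((p.2 : ℤ) * ν p.1 : ℤ) : ZMod D) = r)).card ≤ m') :
    ∑ i ∈ R, ‖∑ l ∈ Icc 1 L, ∑ m ∈ Icc 1 M, x l * y m * e ((l : ℝ) * (m : ℝ) * (ν i : ℝ) / D)‖ ≤
      Real.sqrt (R.card : ℝ) * Real.sqrt (∑ l ∈ Icc 1 L, ‖x l‖ ^ 2) *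
        Real.sqrt ((m' : ℝ) * (((M : ℝ) + 1 + 2 * D) * ∑ m ∈ Icc 1 M, ‖y m‖ ^ 2)) := by
  have h := sum_norm_bilinear_sq_le R ν hD L M x y hm'
  have h0 : 0 ≤ ∑ i ∈ R, ‖∑ l ∈ Icc 1 L, ∑ m ∈ Icc 1 M, x l * y m * e ((l : ℝ) * (m : ℝ) * (ν i : ℝ) / D)‖ :=
    Finset.sum_nonneg fun _ _ ↦ norm_nonneg _
  rw [← Real.sqrt_mul' _ (Finset.sum_nonneg fun _ _ ↦ by positivity), ← Real.sqrt_mul' _ (by positivity)]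
  exact Real.le_sqrt_of_sq_le h

/-! ### Append 1: the `ℓ²` and weighted forms of the bilinear bound; the multiplicity of an interval family -/

/-- **Bilinear sums over a family of rational frequencies (`ℓ²` form)**: under the hypotheses of
`sum_norm_bilinear_sq_le`, `Σ_{i∈R} ‖Σ_{l≤L} Σ_{m≤M} x_l y_m e(l·m·ν_i/D)‖² ≤ (Σ_l ‖x_l‖²)·(m′·(M + 1 + 2D)·Σ_m ‖y_m‖²)`
(Cauchy–Schwarz in `l` for each `i`, then `largeSieve_family_mod_nat` for the numerators `l·ν_i`). [folklore] -/
theorem sum_norm_sq_bilinear_le {ι : Type*} (R : Finset ι) (ν : ι → ℤ) {D : ℕ} (hD : 0 < D) (L M : ℕ)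
    (x y : ℕ → ℂ) {m' : ℕ}
    (hm' : ∀ r : ZMod D, ((R ×ˢ Icc 1 L).filter (fun p ↦ (((p.2 : ℤ) * ν p.1 : ℤ) : ZMod D) = r)).card ≤ m') :
    ∑ i ∈ R, ‖∑ l ∈ Icc 1 L, ∑ m ∈ Icc 1 M, x l * y m * e ((l : ℝ) * (m : ℝ) * (ν i : ℝ) / D)‖ ^ 2 ≤
      (∑ l ∈ Icc 1 L, ‖x l‖ ^ 2) * ((m' : ℝ) * (((M : ℝ) + 1 + 2 * D) * ∑ m ∈ Icc 1 M, ‖y m‖ ^ 2)) := by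
  classical
  set A : ι × ℕ → ℂ := fun p ↦ ∑ m ∈ Icc 1 M, y m * e ((m : ℝ) * (((p.2 : ℤ) * ν p.1 : ℤ) : ℝ) / D) with hA
  set X : ℝ := ∑ l ∈ Icc 1 L, ‖x l‖ ^ 2 with hX
  have hX0 : 0 ≤ X := Finset.sum_nonneg fun _ _ ↦ by positivity
  have hB : ∀ i, ∑ l ∈ Icc 1 L, ∑ m ∈ Icc 1 M, x l * y m * e ((l : ℝ) * (m : ℝ) * (ν i : ℝ) / D) =
      ∑ l ∈ Icc 1 L, x l * A (i, l) := by
    intro i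
    refine Finset.sum_congr rfl fun l _ ↦ ?_
    rw [hA, Finset.mul_sum]
    refine Finset.sum_congr rfl fun m _ ↦ ?_
    push_cast
    rw [mul_assoc]
    congr 3
    ring
  have hCS : ∀ i, ‖∑ l ∈ Icc 1 L, x l * A (i, l)‖ ^ 2 ≤ X * ∑ l ∈ Icc 1 L, ‖A (i, l)‖ ^ 2 := by
    intro i
    have h1 : ‖∑ l ∈ Icc 1 L, x l * A (i, l)‖ ≤ ∑ l ∈ Icc 1 L, ‖x l‖ * ‖A (i, l)‖ :=
      (norm_sum_le _ _).trans (le_of_eq (Finset.sum_congr rfl fun l _ ↦ norm_mul _ _))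
    calc ‖∑ l ∈ Icc 1 L, x l * A (i, l)‖ ^ 2 ≤ (∑ l ∈ Icc 1 L, ‖x l‖ * ‖A (i, l)‖) ^ 2 :=
          pow_le_pow_left₀ (norm_nonneg _) h1 2
      _ ≤ (∑ l ∈ Icc 1 L, ‖x l‖ ^ 2) * ∑ l ∈ Icc 1 L, ‖A (i, l)‖ ^ 2 :=
          Finset.sum_mul_sq_le_sq_mul_sq _ _ _
  have hLS : ∑ p ∈ R ×ˢ Icc 1 L, ‖A p‖ ^ 2 ≤ (m' : ℝ) * (((M : ℝ) + 1 + 2 * D) * ∑ m ∈ Icc 1 M, ‖y m‖ ^ 2) :=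
    largeSieve_family_mod_nat (R ×ˢ Icc 1 L) (fun p ↦ (p.2 : ℤ) * ν p.1) hD hm' y M
  simp_rw [hB]
  calc ∑ i ∈ R, ‖∑ l ∈ Icc 1 L, x l * A (i, l)‖ ^ 2
      ≤ ∑ i ∈ R, X * ∑ l ∈ Icc 1 L, ‖A (i, l)‖ ^ 2 := Finset.sum_le_sum fun i _ ↦ hCS i
    _ = X * ∑ p ∈ R ×ˢ Icc 1 L, ‖A p‖ ^ 2 := by rw [← Finset.mul_sum, Finset.sum_product]
    _ ≤ X * ((m' : ℝ) * (((M : ℝ) + 1 + 2 * D) * ∑ m ∈ Icc 1 M, ‖y m‖ ^ 2)) :=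
        mul_le_mul_of_nonneg_left hLS hX0

/-- **Weighted bilinear form over a family of rational frequencies**: under the hypotheses of `sum_norm_bilinear_sq_le`
and for any complex weights `w_i`,
`‖Σ_{i∈R} w_i · Σ_{l≤L} Σ_{m≤M} x_l y_m e(l·m·ν_i/D)‖ ≤ √(Σ_i ‖w_i‖²) · √((Σ_l ‖x_l‖²)·(m′·(M + 1 + 2D)·Σ_m ‖y_m‖²))`
(Cauchy–Schwarz over the family and `sum_norm_sq_bilinear_le`). [folklore] -/
theorem norm_sum_weighted_bilinear_le {ι : Type*} (R : Finset ι) (ν : ι → ℤ) {D : ℕ} (hD : 0 < D) (L M : ℕ)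
    (x y : ℕ → ℂ) (w : ι → ℂ) {m' : ℕ}
    (hm' : ∀ r : ZMod D, ((R ×ˢ Icc 1 L).filter (fun p ↦ (((p.2 : ℤ) * ν p.1 : ℤ) : ZMod D) = r)).card ≤ m') :
    ‖∑ i ∈ R, w i * ∑ l ∈ Icc 1 L, ∑ m ∈ Icc 1 M, x l * y m * e ((l : ℝ) * (m : ℝ) * (ν i : ℝ) / D)‖ ≤
      Real.sqrt (∑ i ∈ R, ‖w i‖ ^ 2) *
        Real.sqrt ((∑ l ∈ Icc 1 L, ‖x l‖ ^ 2) *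
          ((m' : ℝ) * (((M : ℝ) + 1 + 2 * D) * ∑ m ∈ Icc 1 M, ‖y m‖ ^ 2))) := by
  have h := sum_norm_sq_bilinear_le R ν hD L M x y hm'
  set B : ι → ℂ := fun i ↦ ∑ l ∈ Icc 1 L, ∑ m ∈ Icc 1 M, x l * y m * e ((l : ℝ) * (m : ℝ) * (ν i : ℝ) / D)
    with hBdef
  calc ‖∑ i ∈ R, w i * B i‖ ≤ ∑ i ∈ R, ‖w i‖ * ‖B i‖ :=
        (norm_sum_le _ _).trans (le_of_eq (Finset.sum_congr rfl fun i _ ↦ norm_mul _ _))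
    _ ≤ Real.sqrt (∑ i ∈ R, ‖w i‖ ^ 2) * Real.sqrt (∑ i ∈ R, ‖B i‖ ^ 2) :=
        Real.sum_mul_le_sqrt_mul_sqrt R (fun i ↦ ‖w i‖) (fun i ↦ ‖B i‖)
    _ ≤ Real.sqrt (∑ i ∈ R, ‖w i‖ ^ 2) *
        Real.sqrt ((∑ l ∈ Icc 1 L, ‖x l‖ ^ 2) *
          ((m' : ℝ) * (((M : ℝ) + 1 + 2 * D) * ∑ m ∈ Icc 1 M, ‖y m‖ ^ 2))) := by
        gcongr

/-- **Multiplicity of an interval family**: for integers `a ≤ b`, `D ≥ 1` and any residue `r` mod `D`,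
`#{k ∈ (a, b] : k ≡ r (mod D)} ≤ (b − a)/D + 1` (the exact count is Mathlib's `Int.Ioc_filter_modEq_card`). [folklore] -/
theorem card_Ioc_filter_intCast_eq_le {D : ℕ} (hD : 0 < D) {a b : ℤ} (hab : a ≤ b) (r : ZMod D) :
    ((((Ioc a b).filter (fun k : ℤ ↦ (k : ZMod D) = r)).card : ℕ) : ℝ) ≤ ((b - a : ℤ) : ℝ) / D + 1 := by
  classical
  haveI : NeZero D := ⟨hD.ne'⟩
  set v : ℤ := (r.val : ℤ) with hv
  have hfilt : (Ioc a b).filter (fun k : ℤ ↦ (k : ZMod D) = r) =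
      (Ioc a b).filter (fun k : ℤ ↦ k ≡ v [ZMOD (D : ℤ)]) := by
    refine Finset.filter_congr fun k _ ↦ ?_
    rw [hv, ← ZMod.intCast_eq_intCast_iff, Int.cast_natCast, ZMod.natCast_zmod_val]
  have hcard := Int.Ioc_filter_modEq_card a b (by exact_mod_cast hD : (0 : ℤ) < D) v
  rw [hfilt]
  have hDq : (0 : ℚ) < D := by exact_mod_cast hD
  -- the floor count is at most `(b - a)/D + 1`, in `ℚ`
  have hq : ((max (⌊((b : ℚ) - v) / (D : ℚ)⌋ - ⌊((a : ℚ) - v) / (D : ℚ)⌋) 0 : ℤ) : ℚ) ≤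
      ((b : ℚ) - a) / D + 1 := by
    have h1 : ((⌊((b : ℚ) - v) / (D : ℚ)⌋ : ℤ) : ℚ) ≤ ((b : ℚ) - v) / D := Int.floor_le _
    have h2 : ((a : ℚ) - v) / D < ((⌊((a : ℚ) - v) / (D : ℚ)⌋ : ℤ) : ℚ) + 1 := Int.lt_floor_add_one _
    have h3 : ((b : ℚ) - v) / D - ((a : ℚ) - v) / D = ((b : ℚ) - a) / D := by
      field_simp; ring
    have h0 : (0 : ℚ) ≤ ((b : ℚ) - a) / D + 1 := by
      have : (0 : ℚ) ≤ (b : ℚ) - a := by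
        have : (a : ℚ) ≤ b := by exact_mod_cast hab
        linarith
      positivity
    rcases le_total (⌊((b : ℚ) - v) / (D : ℚ)⌋ - ⌊((a : ℚ) - v) / (D : ℚ)⌋) 0 with hle | hge
    · rw [max_eq_right hle]; simpa using h0
    · rw [max_eq_left hge]; push_cast; linarith
  have hz : (((((Ioc a b).filter (fun k : ℤ ↦ k ≡ v [ZMOD (D : ℤ)])).card : ℕ) : ℤ) : ℚ) ≤
      ((b : ℚ) - a) / D + 1 := by rw [hcard]; exact hq
  have hR : ((((((Ioc a b).filter (fun k : ℤ ↦ k ≡ v [ZMOD (D : ℤ)])).card : ℕ) : ℤ) : ℚ) : ℝ) ≤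
      ((((b : ℚ) - a) / D + 1 : ℚ) : ℝ) := by exact_mod_cast hz
  push_cast at hR ⊢
  exact hR

end Summit.Parity.GeneralizedHardyLittlewood.Theorems.BeyondDiagonalBeatsQuarter.OffDiag
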